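import Literature.Geometry.Lorentzian.CauchyHypersurfaceChronology
import Literature.Geometry.Lorentzian.SpacelikePieceDomain
import Literature.Geometry.Lorentzian.CausalCurveNullGeodesic
import HarnessLib

/-!
# A spacetime with a spacelike Cauchy hypersurface is causal (O'Neill 1983, Ch. 14, Cor. 14.39)

Second half of "Cauchy developments are causal": on a time-oriented Lorentzian manifold `(M, g, τ)`
(Hausdorff, second countable, boundaryless finite-dimensional complete model, smooth metric
`∞ ≤ n`, Levi-Civita connection) with a Cauchy hypersurface `S` which is *spacelike* in the
first-order sense of `SpacelikePieceDomain.lean` (at every point a future timelike `ν` with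
`g(ν, φ σ - φ a) = o(‖φ σ - φ a‖)` along `S`), **there is no closed causal curve**:

* `LorentzianMetric.IsCauchyHypersurface.isCausallyWellBehaved_of_spacelike` — `IsCausallyWellBehaved`,
  the first clause of the tree's `IsGloballyHyperbolic` (Bernal–Sánchez form).

Proof. Let `γ` be a future causal curve on `[a, b]`, `a < b`, `γ a = γ b = p`. If the velocities at
the two ends are not positively proportional, the loop has a corner at `p` and
`mem_chronologicalFuture_of_corner` (`NullCornerChronology.lean`) gives `p ≪ p`, a closed timelike
curve, excluded by `IsCauchyHypersurface.isChronological`. Otherwise the dichotomy for causal curves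
(`mem_chronologicalFuture_or_exists_null_maximalGeodesic`) either gives `p ≪ p` again or exhibits
`γ` as a reparametrisation of the maximal null geodesic `μ = γ_{(p, ℓ)}`, which then returns to `p`
at a parameter `L > 0` with velocity `λ ℓ`, `λ > 0`. By the flow and rescaling properties of
maximal geodesics (`selfSimilar_of_maximalGeodesic_return`) the domain `D` of `μ` is invariant under
`σ(u) = L + u/λ` and `μ ∘ σ = μ`; an elementary analysis of the iterates of `σ`
(`not_hasFutureEndpoint_of_selfSimilar`: they increase to `+∞` or to the fixed point of `σ`, which is
then not in `D`, carrying the values `μ 0 = p` and `μ t₁ ≠ p` along) shows that `μ|_D` has no future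
endpoint, and — applied to the reversed curve — no past endpoint. So `μ` is an endless causal curve;
it meets the Cauchy hypersurface at some `u` (`IsCauchyHypersurface.exists_mem_of_isEndlessCausalCurve_holds`)
and again at `σ u ≠ u`: a causal curve from `S` to `S`, contradicting the acausality of spacelike
Cauchy hypersurfaces (`IsCauchyHypersurface.false_of_isFutureCausalCurveOn_of_spacelike`).

Also: `HasFutureEndpoint.tendsto_of_cofinal`, `LorentzianMetric.exists_ne_of_velocity_ne_zero`
(a curve with nonzero velocity is not constant to the right of the parameter).

Everything is proved; no definitions, no named facts (D-0026).

## References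

* B. O'Neill, *Semi-Riemannian geometry with applications to relativity*, Academic Press 1983,
  Ch. 14, Lemma 14.37, Thm. 14.38, Cor. 14.39 (pp. 422–423); Ch. 10, Prop. 10.46.
  [ONeillSemiRiemannian1983]
* S. W. Hawking, G. F. R. Ellis, *The large scale structure of space-time*, CUP 1973, §6.6,
  Prop. 6.6.3. [HawkingEllis1973CUP]
* J. M. Lee, *Introduction to Riemannian Manifolds*, 2nd ed. (2018), Thm. 4.27, Lemma 5.18 (flow
  and rescaling of maximal geodesics). [LeeRiemannianManifolds2018]
-/

noncomputable section

open Bundle Set Filter Function Topology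
open scoped Manifold ContDiff Topology

namespace Literature.Geometry.Lorentzian

open Literature.Geometry.Riemannian

variable {E : Type*} [NormedAddCommGroup E] [NormedSpace ℝ E] {H : Type*} [TopologicalSpace H]
  {I : ModelWithCorners ℝ E H} {n : ℕ∞ω} {M : Type*} [TopologicalSpace M] [ChartedSpace H M]
  [IsManifold I ∞ M]

/-! ### Real-analysis core: an affinely self-similar curve has no endpoint -/

omit [IsManifold I ∞ M] in
/-- Along a cofinal sequence of parameters a future endpoint is the limit of the values. [folklore] -/
theorem HasFutureEndpoint.tendsto_of_cofinal {γ : ℝ → M} {s : Set ℝ} {x : M}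
    (h : HasFutureEndpoint γ s x) {a : ℕ → ℝ} (ha : ∀ j, a j ∈ s)
    (hcof : ∀ d ∈ s, ∀ᶠ j in atTop, d ≤ a j) : Tendsto (fun j ↦ γ (a j)) atTop (𝓝 x) := by
  have ht : Tendsto (fun j ↦ (⟨a j, ha j⟩ : s)) atTop atTop :=
    tendsto_atTop.2 fun d ↦ (hcof d d.2).mono fun j hj ↦ Subtype.mk_le_mk.2 hj
  exact h.comp ht

omit [IsManifold I ∞ M] in
/-- **An affinely self-similar curve has no future endpoint.** Let `μ` be continuous at the points
of the interval `D ∋ 0` and invariant under the affine map `σ u = L + u / λ` (`L, λ > 0`):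
`σ` preserves `D` and `μ ∘ σ = μ` on `D`; suppose `μ` takes two different values at `0` and at
some `t₁ ∈ [0, L]`. Then `μ|_D` has no future endpoint, and if `λ > 1` the interval `D` lies
strictly below the fixed point `L / (1 - λ⁻¹)` of `σ` (the iterates `σʲ 0`, `σʲ t₁` increase to
`+∞` or to the fixed point, carrying the two values along). This is the parameter structure of a
closed null geodesic returning with rescaled velocity. [folklore] -/
theorem not_hasFutureEndpoint_of_selfSimilar [T2Space M] {μ : ℝ → M} {D : Set ℝ}
    (hD : D.OrdConnected) (hcont : ∀ u ∈ D, ContinuousAt μ u) {L lam : ℝ} (hL : 0 < L)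
    (hlam : 0 < lam) (h0 : (0 : ℝ) ∈ D) (hσD : ∀ u ∈ D, L + lam⁻¹ * u ∈ D)
    (hμσ : ∀ u ∈ D, μ (L + lam⁻¹ * u) = μ u) {t₁ : ℝ} (ht₁ : t₁ ∈ Icc 0 L)
    (hne : μ t₁ ≠ μ 0) :
    (∀ x, ¬ HasFutureEndpoint μ D x) ∧ (1 < lam → ∀ u ∈ D, u < L / (1 - lam⁻¹)) := by
  set σ : ℝ → ℝ := fun u ↦ L + lam⁻¹ * u with hσ
  have hLD : L ∈ D := by simpa [hσ] using hσD 0 h0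
  have hIcc : Icc 0 L ⊆ D := hD.out h0 hLD
  have ht₁D : t₁ ∈ D := hIcc ht₁
  -- iterates
  have hitD : ∀ (j : ℕ) (u : ℝ), u ∈ D → σ^[j] u ∈ D := by
    intro j
    induction j with
    | zero => intro u hu; simpa using hu
    | succ j ih => intro u hu; rw [Function.iterate_succ_apply']; exact hσD _ (ih u hu)
  have hitμ : ∀ (j : ℕ) (u : ℝ), u ∈ D → μ (σ^[j] u) = μ u := by
    intro j
    induction j with
    | zero => intro u _; simp
    | succ j ih => intro u hu; rw [Function.iterate_succ_apply', hμσ _ (hitD j u hu), ih u hu]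
  -- the contradiction from two cofinal value-carrying sequences
  have hcontra : ∀ x : M, HasFutureEndpoint μ D x → (∀ d ∈ D, ∀ᶠ j in atTop, d ≤ σ^[j] 0) →
      (∀ d ∈ D, ∀ᶠ j in atTop, d ≤ σ^[j] t₁) → False := by
    intro x hx hc0 hc1
    have h1 := hx.tendsto_of_cofinal (fun j ↦ hitD j 0 h0) hc0
    have h2 := hx.tendsto_of_cofinal (fun j ↦ hitD j t₁ ht₁D) hc1
    simp only [hitμ _ 0 h0, hitμ _ t₁ ht₁D] at h1 h2
    have e1 : x = μ 0 := tendsto_nhds_unique h1 tendsto_const_nhds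
    have e2 : x = μ t₁ := tendsto_nhds_unique h2 tendsto_const_nhds
    exact hne (e2.symm.trans e1)
  rcases le_or_gt lam 1 with hle | hgt
  · -- Case `λ ≤ 1`: the iterates grow at least linearly
    have hinv : 1 ≤ lam⁻¹ := (one_le_inv₀ hlam).2 hle
    have hgrow : ∀ (j : ℕ) (u : ℝ), 0 ≤ u → u + j * L ≤ σ^[j] u := by
      intro j
      induction j with
      | zero => intro u _; simp
      | succ j ih =>
        intro u hu
        rw [Function.iterate_succ_apply']
        have h := ih u hu
        have hpos : 0 ≤ σ^[j] u := le_trans (by positivity) h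
        show u + (↑(j + 1) : ℝ) * L ≤ L + lam⁻¹ * σ^[j] u
        have : σ^[j] u ≤ lam⁻¹ * σ^[j] u := le_mul_of_one_le_left hpos hinv
        push_cast
        linarith
    have hcof : ∀ u, 0 ≤ u → u ∈ D → ∀ d ∈ D, ∀ᶠ j in atTop, d ≤ σ^[j] u := by
      intro u hu _ d _
      obtain ⟨J, hJ⟩ := exists_nat_ge ((d - u) / L)
      refine eventually_atTop.2 ⟨J, fun j hj ↦ ?_⟩
      have h1 := hgrow j u hu
      have h2 : (d - u) / L ≤ j := hJ.trans (by exact_mod_cast hj)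
      rw [div_le_iff₀ hL] at h2
      linarith
    refine ⟨fun x hx ↦ hcontra x hx (hcof 0 le_rfl h0) (hcof t₁ ht₁.1 ht₁D), fun h ↦ ?_⟩
    linarith
  · -- Case `λ > 1`: the iterates increase to the fixed point `u⋆`
    have hq : 1 - lam⁻¹ ∈ Ioo (0 : ℝ) 1 := by
      constructor
      · have : lam⁻¹ < 1 := inv_lt_one_of_one_lt₀ hgt
        linarith
      · have : 0 < lam⁻¹ := by positivity
        linarith
    set ustar : ℝ := L / (1 - lam⁻¹) with hustar
    have hustar_pos : 0 < ustar := div_pos hL hq.1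
    have hLlt : L < ustar := by
      rw [hustar, lt_div_iff₀ hq.1]; nlinarith [hq.2]
    have hfix : ∀ u, σ u - ustar = lam⁻¹ * (u - ustar) := by
      intro u
      show L + lam⁻¹ * u - ustar = lam⁻¹ * (u - ustar)
      have : ustar * (1 - lam⁻¹) = L := by rw [hustar]; field_simp
      linarith [this]
    have hclosed : ∀ (j : ℕ) (u : ℝ), σ^[j] u - ustar = (lam⁻¹) ^ j * (u - ustar) := by
      intro j
      induction j with
      | zero => intro u; simp
      | succ j ih => intro u; rw [Function.iterate_succ_apply', hfix, ih u, pow_succ]; ring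
    have htend : ∀ u, Tendsto (fun j : ℕ ↦ σ^[j] u) atTop (𝓝 ustar) := by
      intro u
      have h1 : Tendsto (fun j : ℕ ↦ (lam⁻¹) ^ j * (u - ustar)) atTop (𝓝 (0 * (u - ustar))) :=
        (tendsto_pow_atTop_nhds_zero_of_lt_one (by positivity)
          (inv_lt_one_of_one_lt₀ hgt)).mul_const _
      rw [zero_mul] at h1
      have h2 : (fun j : ℕ ↦ σ^[j] u) = fun j ↦ (lam⁻¹) ^ j * (u - ustar) + ustar := by
        funext j; linarith [hclosed j u]
      rw [h2]
      have := h1.add_const ustar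
      rwa [zero_add] at this
    -- `u⋆ ∉ D`
    have hnot : ustar ∉ D := by
      intro hmem
      have hc := hcont ustar hmem
      have h1 : Tendsto (fun j : ℕ ↦ μ (σ^[j] 0)) atTop (𝓝 (μ ustar)) := hc.tendsto.comp (htend 0)
      have h2 : Tendsto (fun j : ℕ ↦ μ (σ^[j] t₁)) atTop (𝓝 (μ ustar)) := hc.tendsto.comp (htend t₁)
      simp only [hitμ _ 0 h0, hitμ _ t₁ ht₁D] at h1 h2
      have e1 : μ ustar = μ 0 := tendsto_nhds_unique h1 tendsto_const_nhds
      have e2 : μ ustar = μ t₁ := tendsto_nhds_unique h2 tendsto_const_nhds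
      exact hne (e2.symm.trans e1)
    have hbelow : ∀ u ∈ D, u < ustar := by
      intro u hu
      by_contra hge
      push Not at hge
      exact hnot (hD.out h0 hu ⟨hustar_pos.le, hge⟩)
    have hcof : ∀ u, u ∈ D → ∀ d ∈ D, ∀ᶠ j in atTop, d ≤ σ^[j] u := by
      intro u _ d hd
      exact ((htend u).eventually_const_lt (hbelow d hd)).mono fun j hj ↦ hj.le
    exact ⟨fun x hx ↦ hcontra x hx (hcof 0 h0) (hcof t₁ ht₁D), fun _ ↦ hbelow⟩

namespace LorentzianMetric

/-- **A curve with nonzero velocity at `m` is not constant to the right of `m`** (generalising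
`exists_ne_of_isFutureTimelikeCurveOn` from timelike to any differentiable curve with nonzero
velocity, e.g. a causal curve). [folklore] -/
theorem exists_ne_of_velocity_ne_zero {γ : ℝ → M} {m : ℝ} (hd : MDifferentiableAt 𝓘(ℝ, ℝ) I γ m)
    (hv : velocity I γ m ≠ 0) {P : ℝ} (hP : 0 < P) : ∃ u ∈ Ioo m (m + P), γ u ≠ γ m := by
  by_contra hcon
  push Not at hcon
  set eT := trivializationAt E (TangentSpace I) (γ m) with heT
  set w : E := eT.continuousLinearMapAt ℝ (γ m) (velocity I γ m) with hw
  have hderiv : HasDerivAt (extChartAt I (γ m) ∘ γ) w m :=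
    hasDerivAt_extChartAt_comp_continuousLinearMapAt (p := γ m) hd (mem_chart_source H (γ m))
  have hb : γ m ∈ eT.baseSet := by
    rw [heT, TangentBundle.trivializationAt_baseSet]; exact mem_chart_source H (γ m)
  have hw0 : w ≠ 0 := by
    intro h0
    have h1 : eT.symmL ℝ (γ m) w = velocity I γ m := eT.symmL_continuousLinearMapAt hb _
    rw [h0, map_zero] at h1
    exact hv h1.symm
  have hconst : HasDerivWithinAt (extChartAt I (γ m) ∘ γ) 0 (Ici m) m := by
    have h0 : HasDerivWithinAt (fun _ : ℝ ↦ extChartAt I (γ m) (γ m)) 0 (Ici m) m :=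
      hasDerivWithinAt_const m (Ici m) _
    refine h0.congr_of_eventuallyEq_of_mem ?_ (self_mem_Ici)
    have : Ico m (m + P) ∈ 𝓝[Ici m] m := Ico_mem_nhdsGE (by linarith)
    filter_upwards [this] with u hu
    rcases hu.1.eq_or_lt with h | h
    · simp only [comp_apply, ← h]
    · simp only [comp_apply, hcon u ⟨h, hu.2⟩]
  exact hw0 ((uniqueDiffOn_Ici m m self_mem_Ici).eq_deriv _ hderiv.hasDerivWithinAt hconst)

end LorentzianMetric

/-! ### A closed null geodesic returning with rescaled velocity is affinely self-similar -/

section Geodesic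

variable [FiniteDimensional ℝ E] [CompleteSpace E] [T2Space M] [I.Boundaryless]
  {cov : CovariantDerivative I E (TangentSpace I : M → Type _)}
  [CovariantDerivative.ContMDiffCovariantDerivative cov 1]

/-- **Flow and rescaling for a returning geodesic.** If the maximal geodesic `μ = γ_{(p, ℓ)}`
returns to `p` at the parameter `L ∈ dom μ` with velocity `λ ℓ`, `λ > 0`, then its domain `D` is
invariant under `u ↦ L + u / λ` (in both directions) and `μ (L + u / λ) = μ u` on `D`: the
translate `s ↦ μ (s + L)` and the rescaling `s ↦ μ (λ s)` are both the maximal geodesic with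
initial data `(p, λ ℓ)` (`maximalGeodesic_translate`, `add_mem_maximalGeodesicDomain_of_translate`,
`maximalGeodesic_smul_of_mem`). [cite: LeeRiemannianManifolds2018, Thm. 4.27 and Lemma 5.18] -/
theorem selfSimilar_of_maximalGeodesic_return {p : M} {ℓ : TangentSpace I p} {L lam : ℝ}
    (hlam : 0 < lam) (hL : L ∈ maximalGeodesicDomain cov p ℓ)
    (hμL : maximalGeodesic cov p ℓ L = p)
    (hvel : velocity I (maximalGeodesic cov p ℓ) L = lam • ℓ) (u : ℝ) :
    (u ∈ maximalGeodesicDomain cov p ℓ ↔ L + lam⁻¹ * u ∈ maximalGeodesicDomain cov p ℓ) ∧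
      (u ∈ maximalGeodesicDomain cov p ℓ →
        maximalGeodesic cov p ℓ (L + lam⁻¹ * u) = maximalGeodesic cov p ℓ u) := by
  set μ := maximalGeodesic cov p ℓ with hμ
  set D := maximalGeodesicDomain cov p ℓ with hD
  -- the returning data, as a point of `TM`, is `(p, λ ℓ)`
  have hkey : (⟨μ L, velocity I μ L⟩ : TangentBundle I M) = ⟨p, lam • ℓ⟩ :=
    Bundle.TotalSpace.ext hμL (heq_of_eq hvel)
  have hgeo_eq : maximalGeodesic cov (μ L) (velocity I μ L) = maximalGeodesic cov p (lam • ℓ) :=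
    congrArg (fun q : TangentBundle I M ↦ maximalGeodesic cov q.proj q.snd) hkey
  have hdom_eq : maximalGeodesicDomain cov (μ L) (velocity I μ L) =
      maximalGeodesicDomain cov p (lam • ℓ) :=
    congrArg (fun q : TangentBundle I M ↦ maximalGeodesicDomain cov q.proj q.snd) hkey
  -- membership: `s + L ∈ D ↔ s ∈ dom γ_{(p, λℓ)} ↔ λ s ∈ D`, with `s = λ⁻¹ u`
  have hmem1 : ∀ s, s + L ∈ D ↔ s ∈ maximalGeodesicDomain cov p (lam • ℓ) := by
    intro s
    constructor
    · intro hs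
      have h := (maximalGeodesic_translate (cov := cov) p ℓ hL hs).1
      rwa [hdom_eq] at h
    · intro hs
      rw [← hdom_eq] at hs
      exact add_mem_maximalGeodesicDomain_of_translate (cov := cov) p ℓ hL hs
  have hmem2 : ∀ s, s ∈ maximalGeodesicDomain cov p (lam • ℓ) ↔ lam * s ∈ D := by
    intro s
    constructor
    · intro hs
      have h1 : lam⁻¹ * (lam * s) ∈ maximalGeodesicDomain cov p (lam • ℓ) := by
        rwa [inv_mul_cancel_left₀ hlam.ne']
      have h2 := (maximalGeodesic_smul_of_mem (cov := cov) p (lam • ℓ) lam⁻¹ h1).1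
      rwa [inv_smul_smul₀ hlam.ne'] at h2
    · intro hs
      exact (maximalGeodesic_smul_of_mem (cov := cov) p ℓ lam hs).1
  have hval : ∀ s, lam * s ∈ D → μ (s + L) = μ (lam * s) := by
    intro s hs
    have hs' : s ∈ maximalGeodesicDomain cov p (lam • ℓ) := (hmem2 s).2 hs
    have hsL : s + L ∈ D := (hmem1 s).2 hs'
    have h1 := (maximalGeodesic_translate (cov := cov) p ℓ hL hsL).2
    have h1' : maximalGeodesic cov (μ L) (velocity I μ L) s = μ (s + L) :=
      congrArg Bundle.TotalSpace.proj h1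
    have h2 := (maximalGeodesic_smul_of_mem (cov := cov) p ℓ lam hs).2
    rw [hgeo_eq] at h1'
    rw [← h1', h2]
  refine ⟨?_, fun hu ↦ ?_⟩
  · have h := (hmem1 (lam⁻¹ * u)).trans (hmem2 (lam⁻¹ * u))
    rw [mul_inv_cancel_left₀ hlam.ne', add_comm] at h
    exact h.symm
  · have h := hval (lam⁻¹ * u) (by rwa [mul_inv_cancel_left₀ hlam.ne'])
    rw [mul_inv_cancel_left₀ hlam.ne', add_comm] at h
    exact h

end Geodesic

/-! ### The causality condition -/

namespace LorentzianMetric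

variable [FiniteDimensional ℝ E] [CompleteSpace E] [T2Space M] [SecondCountableTopology M]
  [I.Boundaryless] {g : LorentzianMetric I n M} [g.HasLeviCivita]
  [CovariantDerivative.ContMDiffCovariantDerivative g.leviCivita 1] {τ : TimeOrientation g}

/-- **A spacetime with a spacelike Cauchy hypersurface is causal** (no closed causal curves; with
`IsCauchyHypersurface.isChronological` this is the first clause of global hyperbolicity,
`IsGloballyHyperbolic`, for Cauchy developments). O'Neill 1983, Ch. 14, Lemma 14.37, Thm. 14.38,
Cor. 14.39; Hawking–Ellis 1973, Prop. 6.6.3. Hypotheses: Hausdorff, second countable, boundaryless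
model, smooth metric (`∞ ≤ n`), `S` a Cauchy hypersurface spacelike at each point in the first-order
sense of `SpacelikePieceDomain.lean` (`hslab`). Proof. Let `γ` be a future causal curve on `[a, b]`,
`a < b`, with `γ a = γ b = p`. (1) If the velocities at the two ends are not positively
proportional, the loop has a corner at `p` and `p ≪ p` (`mem_chronologicalFuture_of_corner`),
a closed timelike curve — excluded by `isChronological`. (2) Otherwise, by the dichotomy for causal
curves (`mem_chronologicalFuture_or_exists_null_maximalGeodesic`) either again `p ≪ p`, or `γ` runs
along the maximal null geodesic `μ` from `(p, ℓ)`, which returns to `p` at `L > 0` with velocity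
`λ ℓ`, `λ > 0`; then `μ (L + u/λ) = μ u` on its domain (`selfSimilar_of_maximalGeodesic_return`), so
`μ` is an endless causal curve (`not_hasFutureEndpoint_of_selfSimilar` and its time reverse), hence
meets `S` at some `u` — and at `L + u/λ ≠ u`: a causal curve from `S` to `S`, against the
acausality of spacelike Cauchy hypersurfaces
(`IsCauchyHypersurface.false_of_isFutureCausalCurveOn_of_spacelike`).
[cite: ONeillSemiRiemannian1983, Ch. 14, Lemma 14.37 and Cor. 14.39 (pp. 422–423); HawkingEllis1973CUP, §6.6, Prop. 6.6.3] -/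
theorem IsCauchyHypersurface.isCausallyWellBehaved_of_spacelike (hn : (∞ : ℕ∞ω) ≤ n) {S : Set M}
    (hS : g.IsCauchyHypersurface τ S)
    (hslab : ∀ a ∈ S, ∃ ν : TangentSpace I a, g.IsTimelike ν ∧
      ∀ κ : ℝ, 0 < κ → ∀ᶠ σ in 𝓝 a, σ ∈ S →
        |g.val a ν (extChartAt I a σ - extChartAt I a a)| ≤
          κ * ‖extChartAt I a σ - extChartAt I a a‖) :
    g.IsCausallyWellBehaved τ := by
  haveI : Fact (1 ≤ n) := ⟨le_trans (by exact_mod_cast le_top) hn⟩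
  have hn1 : (1 : ℕ∞ω) ≤ n := le_trans (by exact_mod_cast le_top) hn
  have hn2 : (2 : ℕ∞ω) ≤ n := le_trans (WithTop.coe_le_coe.mpr le_top : (2 : ℕ∞ω) ≤ ∞) hn
  have hchron : g.IsChronological τ := hS.isChronological
  intro γ a b hab hγ heq
  -- a chronological relation `p ≪ p` would give a closed timelike curve
  have hnoloop : γ b ∉ g.chronologicalFuture τ {γ a} := by
    rintro ⟨q, hq, δ, a', b', hab', hδ, hδa, hδb⟩
    rw [mem_singleton_iff] at hq
    exact hchron δ a' b' hab' hδ (by rw [hδa, hδb, hq, heq])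
  by_cases hcorner : ∃ c : ℝ, 0 < c ∧ (velocity I γ a : E) = c • (velocity I γ b : E)
  swap
  · -- (1) a genuine corner at `p`
    exact hnoloop (mem_chronologicalFuture_of_corner hn1 hab hab hγ hγ heq.symm hcorner)
  -- (2) the ends fit together: the loop runs along a null geodesic
  obtain ⟨c, hc, hcvel⟩ := hcorner
  rcases mem_chronologicalFuture_or_exists_null_maximalGeodesic τ hn hab hγ with hI |
    ⟨ℓ, φ, hℓn, hℓf, hφa, -, hφm, hγμ, hγvel⟩
  · exact hnoloop hI
  set cov := g.leviCivita with hcov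
  obtain ⟨hμmax, hμ0, hμp, hμv⟩ := maximalGeodesic_spec' (cov := cov) (γ a) ℓ
  set μ := maximalGeodesic cov (γ a) ℓ with hμ
  set D := maximalGeodesicDomain cov (γ a) ℓ with hD
  have hDo : IsOpen D := hμmax.isOpen
  have hμgeo : IsGeodesicOn cov μ D := hμmax.isGeodesicOn
  -- the return parameter `L = φ b > 0` and the return velocity `λ ℓ`
  have haI : a ∈ Icc a b := left_mem_Icc.2 hab.le
  have hbI : b ∈ Icc a b := right_mem_Icc.2 hab.le
  have hLpos : 0 < φ b := by rw [← hφa]; exact hφm haI hbI hab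
  have hLD : φ b ∈ D := (hγμ b hbI).1
  have hμL : μ (φ b) = γ a := by
    have h := (hγμ b hbI).2
    rw [← heq] at h
    exact h.symm
  obtain ⟨ca, hca, hva⟩ := hγvel a haI
  obtain ⟨cb, hcb, hvb⟩ := hγvel b hbI
  rw [hφa, hμv] at hva
  -- `velocity γ a = ca • ℓ`, `velocity γ b = cb • velocity μ (φ b)`, `velocity γ a = c • velocity γ b`
  set lam : ℝ := ca / (c * cb) with hlam_def
  have hlam : 0 < lam := by positivity
  have key : ∀ (va vb vμ l : E) (c' ca' cb' : ℝ), 0 < c' → 0 < cb' → va = ca' • l →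
      vb = cb' • vμ → va = c' • vb → vμ = (ca' / (c' * cb')) • l := by
    intro va vb vμ l c' ca' cb' hc' hcb' h1 h2 h3
    have hne0 : (c' * cb' : ℝ) ≠ 0 := by positivity
    have h4 : (c' * cb') • vμ = ca' • l := by rw [← h1, h3, h2, smul_smul]
    calc vμ = (c' * cb')⁻¹ • ((c' * cb') • vμ) := by rw [inv_smul_smul₀ hne0]
      _ = (c' * cb')⁻¹ • (ca' • l) := by rw [h4]
      _ = (ca' / (c' * cb')) • l := by rw [smul_smul, div_eq_inv_mul]
  have hvel : (velocity I μ (φ b) : E) = lam • (ℓ : E) :=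
    key _ _ _ _ c ca cb hc hcb hva hvb hcvel
  set L : ℝ := φ b with hL_def
  -- self-similarity
  have hss := selfSimilar_of_maximalGeodesic_return (cov := cov) hlam hLD hμL hvel
  have hσD : ∀ u ∈ D, L + lam⁻¹ * u ∈ D := fun u hu ↦ ((hss u).1).1 hu
  have hμσ : ∀ u ∈ D, μ (L + lam⁻¹ * u) = μ u := fun u hu ↦ (hss u).2 hu
  -- `μ` is a causal curve on `D`, continuous there, with two values on `[0, L]`
  have hμcausal : g.IsFutureCausalCurveOn τ μ D := fun s hs ↦
    ⟨IsGeodesicOn.mdifferentiableAt_holds hμgeo hs,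
      (hμgeo.isNull_and_isFutureDirected_velocity g τ hDo hμmax.2.1 hμ0
        (by rw [hμv, hμp]; exact hℓn) (by rw [hμv, hμp]; exact hℓf) hs).2⟩
  have hcont : ∀ u ∈ D, ContinuousAt μ u := fun u hu ↦ (hμcausal u hu).1.continuousAt
  obtain ⟨t₁, ht₁, hne⟩ := exists_ne_of_velocity_ne_zero (hμcausal 0 hμ0).1
    (by rw [hμv]; exact hℓf.1.2) hLpos
  rw [zero_add] at ht₁
  -- no future endpoint
  obtain ⟨hnofut, hbelow⟩ := not_hasFutureEndpoint_of_selfSimilar hμmax.2.1 hcont hLpos hlam hμ0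
    hσD hμσ ⟨ht₁.1.le, ht₁.2.le⟩ hne
  -- no past endpoint: the reversed curve is self-similar with `L' = λ L`, `λ' = λ⁻¹`
  have hiff : ∀ u, u ∈ D ↔ L + lam⁻¹ * u ∈ D := fun u ↦ (hss u).1
  have hnopast : (∀ x, ¬ HasPastEndpoint μ D x) ∧ (lam < 1 → ∀ u ∈ D, L / (1 - lam⁻¹) < u) := by
    set μ' : ℝ → M := fun v ↦ μ (-v) with hμ'
    set D' : Set ℝ := Neg.neg ⁻¹' D with hD'
    have hD'c : D'.OrdConnected := ordConnected_preimage_neg hμmax.2.1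
    have hcont' : ∀ v ∈ D', ContinuousAt μ' v := fun v hv ↦
      (hcont (-v) hv).comp continuous_neg.continuousAt
    have h0' : (0 : ℝ) ∈ D' := by show -(0 : ℝ) ∈ D; rw [neg_zero]; exact hμ0
    have hL' : 0 < lam * L := by positivity
    have hlam' : 0 < lam⁻¹ := by positivity
    -- `σ' v = λ L + λ v`, and `L + λ⁻¹ (-(λ L + λ v)) = -v`
    have hident : ∀ v, L + lam⁻¹ * (-(lam * L + lam⁻¹⁻¹ * v)) = -v := by
      intro v; rw [inv_inv]; field_simp; ring
    have hσD' : ∀ v ∈ D', lam * L + lam⁻¹⁻¹ * v ∈ D' := by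
      intro v hv
      show -(lam * L + lam⁻¹⁻¹ * v) ∈ D
      rw [hiff, hident]
      exact hv
    have hμσ' : ∀ v ∈ D', μ' (lam * L + lam⁻¹⁻¹ * v) = μ' v := by
      intro v hv
      show μ (-(lam * L + lam⁻¹⁻¹ * v)) = μ (-v)
      have h := hμσ (-(lam * L + lam⁻¹⁻¹ * v)) (hσD' v hv)
      rw [hident] at h
      exact h.symm
    -- the second value: `t₁' = λ (L - t₁)`
    have ht₁' : lam * (L - t₁) ∈ Icc 0 (lam * L) :=
      ⟨by nlinarith [ht₁.2], by nlinarith [ht₁.1]⟩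
    have hne' : μ' (lam * (L - t₁)) ≠ μ' 0 := by
      show μ (-(lam * (L - t₁))) ≠ μ (-0)
      rw [neg_zero]
      have ht₁D : t₁ ∈ D := hμmax.2.1.out hμ0 hLD ⟨ht₁.1.le, ht₁.2.le⟩
      have h := hμσ (lam * (t₁ - L)) (by
        rw [hiff]; convert ht₁D using 1; field_simp; ring)
      have h' : L + lam⁻¹ * (lam * (t₁ - L)) = t₁ := by field_simp; ring
      rw [h'] at h
      rw [show -(lam * (L - t₁)) = lam * (t₁ - L) by ring, ← h]
      exact hne
    obtain ⟨hnf', hbelow'⟩ := not_hasFutureEndpoint_of_selfSimilar hD'c hcont' hL' hlam' h0'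
      hσD' hμσ' ht₁' hne'
    refine ⟨fun x hx ↦ hnf' x ?_, fun hlt u hu ↦ ?_⟩
    · -- `HasPastEndpoint μ D x` is `HasFutureEndpoint μ' D' x`
      have h := (hasPastEndpoint_comp_neg_iff (γ := μ') (s := D') (p := x)).1
      have hD'' : Neg.neg ⁻¹' D' = D := by ext v; simp [hD']
      have hμ'' : (fun t ↦ μ' (-t)) = μ := by funext t; simp [hμ']
      rw [hD'', hμ''] at h
      exact h hx
    · have h1 : 1 < lam⁻¹ := (one_lt_inv₀ hlam).2 hlt
      have h2 := hbelow' h1 (-u) (by show -(-u) ∈ D; rw [neg_neg]; exact hu)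
      rw [inv_inv, lt_div_iff₀ (by linarith : (0 : ℝ) < 1 - lam)] at h2
      -- `h2 : -u * (1 - λ) < λ L`; the claim: `L / (1 - λ⁻¹) < u`
      have e : 1 - lam⁻¹ = (lam - 1) / lam := by field_simp
      rw [e, div_div_eq_mul_div, div_lt_iff_of_neg (by linarith : lam - 1 < 0)]
      nlinarith [h2]
  -- `μ` is an endless causal curve; it meets `S`
  have hend : g.IsEndlessCausalCurve τ μ D :=
    ⟨hμmax.2.1, hμcausal, ⟨⟨0, hμ0⟩, hnofut⟩, ⟨⟨0, hμ0⟩, hnopast.1⟩⟩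
  obtain ⟨uS, huS, huSS⟩ := IsCauchyHypersurface.exists_mem_of_isEndlessCausalCurve_holds hn2 hS hend
  -- and again at `σ uS ≠ uS`
  have huS' : L + lam⁻¹ * uS ∈ D := hσD uS huS
  have hSS' : μ (L + lam⁻¹ * uS) ∈ S := by rw [hμσ uS huS]; exact huSS
  have hneq : L + lam⁻¹ * uS ≠ uS := by
    intro h
    rcases lt_trichotomy lam 1 with hl | hl | hl
    · have h1 := hnopast.2 hl uS huS
      have hq' : 1 - lam⁻¹ < 0 := by
        have : 1 < lam⁻¹ := (one_lt_inv₀ hlam).2 hl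
        linarith
      -- from `L + λ⁻¹ uS = uS`: `uS (1 - λ⁻¹) = L`, i.e. `uS = L / (1 - λ⁻¹)`
      have h2 : uS = L / (1 - lam⁻¹) := by
        rw [eq_div_iff hq'.ne]; linarith
      linarith
    · rw [hl, inv_one, one_mul] at h
      linarith
    · have h1 := hbelow hl uS huS
      have hq' : 0 < 1 - lam⁻¹ := by
        have : lam⁻¹ < 1 := inv_lt_one_of_one_lt₀ hl
        linarith
      have h2 : uS = L / (1 - lam⁻¹) := by
        rw [eq_div_iff hq'.ne']; linarith
      linarith
  rcases lt_or_gt_of_ne hneq with hlt | hlt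
  · exact IsCauchyHypersurface.false_of_isFutureCausalCurveOn_of_spacelike hn2 hS hslab hlt
      (hμcausal.mono (hμmax.2.1.out huS' huS)) hSS' huSS
  · exact IsCauchyHypersurface.false_of_isFutureCausalCurveOn_of_spacelike hn2 hS hslab hlt
      (hμcausal.mono (hμmax.2.1.out huS huS')) huSS hSS'

end LorentzianMetric

end Literature.Geometry.Lorentzian

end
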